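import Literature.Probability.LatticeModels.UrsellMonotonicityDeriv
import Literature.Probability.LatticeModels.UrsellFirstZeroProofs
import HarnessLib

/-!
# Camia–Jiang–Newman 2023, Theorem 1: the case `k = 1` (proved) and the odd-block reduction

Topic `Literature/Probability/LatticeModels`; sibling PROOF file of `UrsellMonotonicity.lean`
(named fact `CamiaJiangNewman2023_thm1`, CJN Thm 1: `(-1)^{k-1} ∂u_{2k}/∂J_{u₀v₀} ≥ 0`).

What is proved here, over the pair-interaction average `PairIsing.avg`:

* `PairIsing.avg_spinProduct_mul_le` — GKS II for `PairIsing.avg` (through `avg_eq_gksExpect`);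
* `PairIsing.avg_prod_spinAt_eq_zero_of_odd` — spin flip: `⟨∏_{i∈B} σ_{x i}⟩_c = 0` for `|B|` odd
  (CJN p. 6: "by symmetry, `⟨σ_P⟩_G = 0` if `|P|` is odd", the remark that reduces the partition sum
  (20) to partitions into even blocks);
* `PairIsing.deriv_ursell_two_nonneg` — in CJN's formula (20) for `n = 2` every partition other
  than the one-block partition has a singleton block `B ≠ Q`, whose factor `⟨σ_B⟩` vanishes, and the
  one-block term is `⟨σ_{j₀}σ_{j₁}σ_{u₀}σ_{v₀}⟩ - ⟨σ_{j₀}σ_{j₁}⟩⟨σ_{u₀}σ_{v₀}⟩ ≥ 0` by GKS II;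
* `CamiaJiangNewman2023_thm1_one` — THEOREM 1 FOR `k = 1`, i.e. the `k = 1` instance of the body
  of the named fact (`u₂ = ⟨σ_{j₀}σ_{j₁}⟩` is non-decreasing in every coupling: the second Griffiths
  inequality, as CJN note for Shlosman's signs at `k = 1`).

The general case `k ≥ 2` is NOT proved here (nor anywhere in the tree): it rests on CJN's
Proposition 1 (Shlosman-type combinatorics of graph partitions), see `UrsellMonotonicity.lean`.

## References
* [CamiaJiangNewman2023] F. Camia, J. Jiang, C. M. Newman, *Monotonicity of Ursell functions in the
  Ising model*, Comm. Math. Phys. 401 (2023), arXiv:2207.12247, §1.1 (Thm 1, Remark 1), §2 eq. (20)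
  and the sentence following it (p. 6 of the arXiv version).
* [FriedliVelenik2017] S. Friedli, Y. Velenik, *Statistical Mechanics of Lattice Systems*, CUP 2017,
  Thm. 3.49 (GKS II).
-/

noncomputable section

open Finset
open scoped symmDiff

namespace Literature.Probability.LatticeModels

namespace PairIsing

variable {ι : Type*} [Fintype ι] [DecidableEq ι]

/-- **GKS II for the pair-interaction average**: `⟨σ_A⟩_c ⟨σ_B⟩_c ≤ ⟨σ_A σ_B⟩_c = ⟨σ_{A ∆ B}⟩_c` for
`c ≥ 0` (through `avg_eq_gksExpect` and the tree's `gksExpect_mul_gksExpect_le`).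
[cite: FriedliVelenik2017, Thm. 3.49, eq. (3.55)] -/
theorem avg_spinProduct_mul_le {c : ι → ι → ℝ} (hc : ∀ a b, 0 ≤ c a b) (A B : Finset ι) :
    avg c (spinProduct A) * avg c (spinProduct B) ≤ avg c (spinProduct (A ∆ B)) := by
  rw [avg_eq_gksExpect, avg_eq_gksExpect, avg_eq_gksExpect]
  exact gksExpect_mul_gksExpect_le _ _ _ (fun p _ => hc p.1 p.2) A B

/-- **Spin flip: odd spin monomials have zero average** (`⟨∏_{i∈B} σ_{x i}⟩_c = 0` if `|B|` is
odd), since `σ ↦ -σ` preserves the weight and reverses the sign of the monomial.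
[cite: CamiaJiangNewman2023, §2, remark after eq. (20)] -/
theorem avg_prod_spinAt_eq_zero_of_odd (c : ι → ι → ℝ) {κ : Type*} (B : Finset κ) (x : κ → ι)
    (hB : Odd B.card) : avg c (fun σ => ∏ i ∈ B, spinAt (x i) σ) = 0 := by
  have h := avg_comp_neg c (fun σ => ∏ i ∈ B, spinAt (x i) σ)
  have hneg : ∀ σ : SpinConfig ι,
      (∏ i ∈ B, spinAt (x i) (-σ)) = (-1 : ℝ) * ∏ i ∈ B, spinAt (x i) σ := by
    intro σ
    simp_rw [spinAt_neg]
    rw [Finset.prod_neg, hB.neg_one_pow]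
  simp_rw [hneg] at h
  rw [avg_const_mul] at h
  linarith

omit [Fintype ι] in
/-- `σ_a σ_b = σ_{{a} ∆ {b}}` (so that GKS II in its `spinProduct` form applies to pair products with
possibly equal sites). [folklore] -/
theorem spinAt_mul_spinAt_eq_spinProduct (a b : ι) (σ : SpinConfig ι) :
    spinAt a σ * spinAt b σ = spinProduct ({a} ∆ {b}) σ := by
  rw [← spinProduct_mul_eq_spinProduct_symmDiff]
  simp [spinProduct]

/-- In a finpartition, a part different from `Q` exists as soon as `Q` is not the whole set.
[folklore] -/
theorem exists_part_ne_of_ne {n : ℕ} (P : Finpartition (univ : Finset (Fin n)))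
    {Q : Finset (Fin n)} (hQ : Q ≠ univ) : ∃ B ∈ P.parts, B ≠ Q := by
  by_contra hall
  have hall' : ∀ B ∈ P.parts, B = Q := fun B hB => by_contra fun h => hall ⟨B, hB, h⟩
  have hle : P.parts.sup id ≤ Q := Finset.sup_le fun B hB => (hall' B hB).le
  rw [P.sup_parts] at hle
  exact hQ (le_antisymm (subset_univ Q) hle)

/-- **CJN Theorem 1 for `n = 2` sites, from eq. (20) and GKS II**: the derivative of
`u₂(c_t; j) = ⟨σ_{j 0}σ_{j 1}⟩_{c_t}` in the coupling `t = c_{u₀v₀}` is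
`⟨σ_{j 0}σ_{j 1}σ_{u₀}σ_{v₀}⟩_c - ⟨σ_{j 0}σ_{j 1}⟩_c⟨σ_{u₀}σ_{v₀}⟩_c ≥ 0` for `c ≥ 0` (in (20) with
`n = 2` the two-block partition contributes `0`: the block `B ≠ Q` is a singleton and `⟨σ_B⟩ = 0`
by spin flip). [cite: CamiaJiangNewman2023, Thm 1 (k = 1) and §2 eq. (20)] -/
theorem deriv_ursell_two_nonneg {c : ι → ι → ℝ} (hc : ∀ a b, 0 ≤ c a b) (j : Fin 2 → ι)
    (u₀ v₀ : ι) :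
    0 ≤ deriv (fun t => ursell (setCoupling c u₀ v₀ t) j) (c u₀ v₀) := by
  rw [deriv_ursell_setCoupling]
  refine Finset.sum_nonneg fun P _ => ?_
  by_cases huniv : (univ : Finset (Fin 2)) ∈ P.parts
  · -- the one-block partition: `P.parts = {univ}`
    have hparts : P.parts = {univ} := by
      refine Finset.eq_singleton_iff_unique_mem.2 ⟨huniv, fun B hB => ?_⟩
      by_contra hne
      have hdisj : Disjoint B univ := P.disjoint hB huniv hne
      obtain ⟨i, hi⟩ := P.nonempty_of_mem_parts hB
      exact (Finset.disjoint_left.1 hdisj hi) (mem_univ i)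
    rw [hparts]
    simp only [card_singleton, Nat.sub_self, pow_zero, Nat.factorial_zero, Nat.cast_one, one_mul,
      sum_singleton, erase_singleton, prod_empty]
    -- GKS II with `A = {j 0} ∆ {j 1}`, `B = {u₀} ∆ {v₀}`
    have hA : (fun σ : SpinConfig ι => ∏ i ∈ (univ : Finset (Fin 2)), spinAt (j i) σ) =
        spinProduct (({j 0} : Finset ι) ∆ {j 1}) := by
      funext σ
      rw [Fin.prod_univ_two, spinAt_mul_spinAt_eq_spinProduct]
    have hAB : (fun σ : SpinConfig ι =>
        (∏ i ∈ (univ : Finset (Fin 2)), spinAt (j i) σ) * (spinAt u₀ σ * spinAt v₀ σ)) =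
        spinProduct ((({j 0} : Finset ι) ∆ {j 1}) ∆ (({u₀} : Finset ι) ∆ {v₀})) := by
      funext σ
      rw [Fin.prod_univ_two, spinAt_mul_spinAt_eq_spinProduct, spinAt_mul_spinAt_eq_spinProduct,
        spinProduct_mul_eq_spinProduct_symmDiff]
    have hB : (fun σ : SpinConfig ι => spinAt u₀ σ * spinAt v₀ σ) =
        spinProduct (({u₀} : Finset ι) ∆ {v₀}) := by
      funext σ
      rw [spinAt_mul_spinAt_eq_spinProduct]
    rw [hA, hAB, hB]
    exact sub_nonneg.2 (avg_spinProduct_mul_le hc _ _)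
  · -- every part `Q` is a proper subset: the inner sum vanishes termwise
    have hzero : ∑ Q ∈ P.parts,
        (∏ B ∈ P.parts.erase Q, avg c (fun σ => ∏ i ∈ B, spinAt (j i) σ)) *
          (avg c (fun σ => (∏ i ∈ Q, spinAt (j i) σ) * (spinAt u₀ σ * spinAt v₀ σ)) -
            avg c (fun σ => ∏ i ∈ Q, spinAt (j i) σ) *
              avg c (fun σ => spinAt u₀ σ * spinAt v₀ σ)) = 0 := by
      refine Finset.sum_eq_zero fun Q hQ => ?_
      have hQne : Q ≠ univ := fun h => huniv (h ▸ hQ)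
      obtain ⟨B, hB, hBQ⟩ := exists_part_ne_of_ne P hQne
      have hBodd : Odd B.card := by
        have hdisj : Disjoint B Q := P.disjoint hB hQ hBQ
        have hBpos := (P.nonempty_of_mem_parts hB).card_pos
        have hQpos := (P.nonempty_of_mem_parts hQ).card_pos
        have hle : B.card + Q.card ≤ 2 := by
          rw [← Finset.card_union_of_disjoint hdisj]
          exact (card_le_univ _).trans (by simp)
        have h1 : B.card = 1 := by omega
        rw [h1]
        exact odd_one
      rw [Finset.prod_eq_zero (Finset.mem_erase.2 ⟨hBQ, hB⟩)
        (avg_prod_spinAt_eq_zero_of_odd c B j hBodd), zero_mul]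
    rw [hzero, mul_zero]

end PairIsing

/-- **Camia–Jiang–Newman 2023, Theorem 1 in the case `k = 1` (PROVED)**: for ferromagnetic pair
interactions `c ≥ 0`, any two sites `j : Fin 2 → ι` and any ordered pair `u₀ ≠ v₀`,
`0 ≤ (-1)^{1-1} · d/dt|_{t = c_{u₀v₀}} u₂(setCoupling c u₀ v₀ t; j)` — the `k = 1` instance of the
body of the named fact `CamiaJiangNewman2023_thm1` (`u₂ = ⟨σ_{j₀}σ_{j₁}⟩`, so this is the second
Griffiths inequality `∂⟨σ_{j₀}σ_{j₁}⟩/∂J_{u₀v₀} = ⟨σ_{j₀}σ_{j₁}σ_{u₀}σ_{v₀}⟩ - ⟨σ_{j₀}σ_{j₁}⟩⟨σ_{u₀}σ_{v₀}⟩ ≥ 0`;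
the hypothesis `u₀ ≠ v₀` is not needed). The general `k` is the named fact and is not proved in
the tree. [cite: CamiaJiangNewman2023, Thm 1 (case k = 1), Remark 1] -/
theorem CamiaJiangNewman2023_thm1_one (ι : Type) [Fintype ι] [DecidableEq ι] (c : ι → ι → ℝ)
    (hc : ∀ a b, 0 ≤ c a b) (j : Fin (2 * 1) → ι) (u₀ v₀ : ι) (_huv : u₀ ≠ v₀) :
    0 ≤ (-1 : ℝ) ^ (1 - 1) *
      deriv (fun t : ℝ => PairIsing.ursell (PairIsing.setCoupling c u₀ v₀ t) j) (c u₀ v₀) := by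
  rw [Nat.sub_self, pow_zero, one_mul]
  exact PairIsing.deriv_ursell_two_nonneg hc j u₀ v₀

end Literature.Probability.LatticeModels
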